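import Mathlib.Geometry.Manifold.Instances.Sphere
import Literature.Topology.FourManifolds.LeeRasmussen
import Literature.Topology.FourManifolds.SliceGenus
import Literature.Topology.FourManifolds.BandSum
import Literature.Topology.FourManifolds.Knots
import Literature.Topology.FourManifolds.KnotGroup
import Literature.Topology.FourManifolds.SliceRibbon
import Literature.Topology.FourManifolds.GaussDiagrams
import HarnessLib

-- D-0014 sorry-sweep (operator, 2026-08-13): sorried theorems -> named facts `def X : Prop`; partial proofs preserved in comments
-- provenance: harness21/H21/H21/Statements/SPC4/Rasmussen.lean @ 190a35b (interim HEAD d8f2665); M5 mechanical rewrite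
/-!
# Rasmussen's `s`-invariant: the target statements (family SPC4, statement **spc4.S28**)

This statement file of the H21 library (family `SPC4`, trunk `FourManL`, outline §3
`Statements/SPC4/Rasmussen.lean`) states Rasmussen's theorems on the concordance invariant
`s(K) ∈ 2ℤ` of a knot `K ⊂ S³` defined from Lee's deformation of Khovanov homology:

* `s` is additive under connected sum (`HasRasmussenInvariant.add`, Rasmussen 2010 Thm. 2)
  and a concordance invariant (`HasRasmussenInvariant.eq_of_isConcordant`, Thm. 1); together
  with `s(K̄) = -s(K)` (`HasRasmussenInvariant.mirror`), `s(unknot) = 0`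
  (`hasRasmussenInvariant_unknot`) and invariance under reversal
  (`HasRasmussenInvariant.reverse`) this says that `s` descends to a group homomorphism
  `Conc(S³) → ℤ` on the smooth knot concordance group;
* the slice-genus bound `|s(K)| ≤ 2 g₄(K)` (`abs_le_two_mul_sliceGenus`, Thm. 1) and its
  corollary `s(K) = 0` for smoothly slice knots (`eq_zero_of_isSmoothlySlice`);
* the value on positive torus knots `s(T(p,q)) = (p-1)(q-1)` (`hasRasmussenInvariant_torusKnot`,
  Thm. 4) and, as a bonus, the Milnor conjecture `g₄(T(p,q)) = (p-1)(q-1)/2`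
  (`sliceGenus_torusKnot`; Kronheimer–Mrowka 1993, Rasmussen 2010 Cor. 3).

All statements are phrased through the accepted knot-level predicate
`Literature.Knot.HasRasmussenInvariant K s` of the prelude file `LeeRasmussen`; that `s(K)` is a
well-defined integer for every knot is the prelude theorem
`Literature.Topology.FourManifolds.Knot.existsUnique_hasRasmussenInvariant` (Rasmussen 2010, Thm. 1, first half), so each
`HasRasmussenInvariant`-conclusion below determines `s` of the knot in question.

## Sources

* J. Rasmussen, *Khovanov homology and the slice genus*, Invent. Math. 182 (2010) 419–447:
  Thm. 1 (`s` is a concordance invariant, `|s(K)| ≤ 2 g₄(K)`), Thm. 2 (`s(K₁ # K₂) =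
  s(K₁) + s(K₂)`, hence a homomorphism `Conc(S³) → ℤ`), Thm. 3 (`s ≤ 1 - χ` bounds),
  Thm. 4 (`s(K) = 2 g₄(K) = 2 g(K)` for positive knots, in particular
  `s(T(p,q)) = (p-1)(q-1)`), Cor. 3 (Milnor conjecture), §3.5 (mirror and reverse).
* P. Kronheimer, T. Mrowka, *Gauge theory for embedded surfaces I*, Topology 32 (1993),
  Cor. 1.3 (Milnor conjecture: `g₄(T(p,q)) = (p-1)(q-1)/2`).
* J. Milnor, *Singular points of complex hypersurfaces* (1968), §1, §10 (torus knots,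
  the conjecture).
* Mathlib (v4.32.0) has no knots, Khovanov/Lee homology, Rasmussen invariant, slice genus or
  torus knots (searched `Khovanov`, `Rasmussen`, `sliceGenus`, `torusKnot`, `Knot`); everything
  used comes from the accepted H21 preludes: `Literature.Topology.FourManifolds.Knot.HasRasmussenInvariant`,
  `Literature.Topology.FourManifolds.Knot.existsUnique_hasRasmussenInvariant` (`LeeRasmussen`), `Literature.Topology.FourManifolds.Knot.sliceGenus`
  (`SliceGenus`), `Literature.Topology.FourManifolds.Knot.IsConnectedSum` (`BandSum`), `Literature.Topology.FourManifolds.unknot`,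
  `Literature.SphereEmbedding.mirror/reverse` (`Knots`), `Literature.Topology.FourManifolds.torusKnot` (`KnotGroup`),
  `Literature.Topology.FourManifolds.Knot.IsConcordant`, `Literature.Topology.FourManifolds.Knot.IsSmoothlySlice` (`SliceRibbon`).

## Design choices

* Every theorem is a known theorem in print and is stated as `theorem … := by sorry`.
* Statements take the invariant as a hypothesis `h : K.HasRasmussenInvariant s` rather than
  through a choice function, following the prelude (no `Classical.choice` on a sorried
  existential).
* **Chirality convention risk** (torus knots). The accepted `Literature.torusKnot p q hp hq h` is the
  embedding `z ↦ (zᵖ, z^q)/√2` (`Literature.Topology.FourManifolds.torusKnotMap`), documented in `KnotGroup` as the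
  right-handed trefoil for `(p, q) = (2, 3)`. Whether the Gauss diagrams produced from it by
  the crossing-sign convention of the accepted `Knot.RegularProjection` / `Knot.HasGaussDiagram`
  are those of the *positive* torus knot (all crossings positive, `s = (p-1)(q-1)`) or of its
  mirror (the negative torus knot, `s = -(p-1)(q-1)`) depends on orientation conventions fixed
  in `FourManM`; `hasRasmussenInvariant_torusKnot` states the positive value and flags the
  risk. The reviewer / prover resolves the sign; the statement id is unaffected, and
  `sliceGenus_torusKnot` is insensitive to it (`sliceGenus_mirror`).
* Notation `𝔼 n`, `𝕊 n` is local, exactly as in the `FourManM` files (not needed in the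
  statements themselves but kept for uniformity of the SPC4 files).
-/

open scoped Manifold ContDiff Topology
open Function Set

noncomputable section

namespace Literature.Topology.FourManifolds

/-- Local notation: `𝔼 n` is the model Euclidean space `EuclideanSpace ℝ (Fin n)`. -/
local notation "𝔼 " n:arg => EuclideanSpace ℝ (Fin n)

/-- Local notation: `𝕊 n` is the unit sphere in `EuclideanSpace ℝ (Fin (n + 1))`. -/
local notation "𝕊 " n:arg => (Metric.sphere (0 : EuclideanSpace ℝ (Fin (n + 1))) 1)

section SPC4

/-! ## `s` is a concordance homomorphism -/

/-- **spc4.S28** (Rasmussen's `s` is additive; Rasmussen 2010, Thm. 2). If `K` is a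
connected sum `K₁ # K₂` then `s(K) = s(K₁) + s(K₂)` (Lee's canonical generators are
multiplicative under the cobordism merging the two components). Together with
`HasRasmussenInvariant.eq_of_isConcordant`, `hasRasmussenInvariant_unknot` and
`HasRasmussenInvariant.mirror` this makes `s` a group homomorphism `Conc(S³) → ℤ` from the
smooth concordance group. Rasmussen (2010), Thm. 2, Prop. 3.11. [cite: Rasmussen2010, Thm. 2] -/
def HasRasmussenInvariant.add : Prop :=
  ∀ {K₁ K₂ K : Knot} {s₁ s₂ : ℤ} (h₁ : K₁.HasRasmussenInvariant s₁) (h₂ : K₂.HasRasmussenInvariant s₂) (hK : Knot.IsConnectedSum K₁ K₂ K),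
    K.HasRasmussenInvariant (s₁ + s₂)

/-- **spc4.S28** (Rasmussen's `s` is a concordance invariant; Rasmussen 2010, Thm. 1).
Concordant knots have the same Rasmussen invariant: a concordance `K ~ K'` is a connected
genus-`0` cobordism, and the induced filtered map on Lee homology (of filtered degree `0`)
carries canonical generators to nonzero multiples of canonical generators. With additivity
(`HasRasmussenInvariant.add`) this says that `s` descends to a homomorphism
`Conc(S³) → ℤ` on the smooth knot concordance group. Rasmussen (2010), Thm. 1, §4
(Prop. 4.1, Cor. 4.3). [cite: Rasmussen2010, Thm. 1] -/
def HasRasmussenInvariant.eq_of_isConcordant : Prop :=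
  ∀ {K K' : Knot} {s s' : ℤ} (h : K.HasRasmussenInvariant s) (h' : K'.HasRasmussenInvariant s') (hc : K.IsConcordant K'),
    s = s'

variable [SphereEmbedding.SmoothnessFacts] in
/-- **spc4.S28** (mirror image; Rasmussen 2010, §3.5). The Rasmussen invariant of the mirror
image is `s(K̄) = -s(K)`: Lee homology of the mirror is the filtered dual. Knot-level form of
the prelude's diagrammatic `GaussDiagram.rasmussenInvariant_mirror`.
Rasmussen (2010), §3.5, proof of Thm. 2. [cite: Rasmussen2010, §3.5] -/
def HasRasmussenInvariant.mirror : Prop :=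
  ∀ {K : Knot} {s : ℤ} (h : K.HasRasmussenInvariant s),
    Knot.HasRasmussenInvariant K.mirror (-s)

variable [SphereEmbedding.SmoothnessFacts] in
/-- **spc4.S28** (reversal; Rasmussen 2010, §3.5). The Rasmussen invariant does not depend on
the orientation of the knot: `s(rK) = s(K)` (Khovanov and Lee homology of a knot are
independent of its orientation). Rasmussen (2010), §3.5. [cite: Rasmussen2010, §3.5] -/
def HasRasmussenInvariant.reverse : Prop :=
  ∀ {K : Knot} {s : ℤ} (h : K.HasRasmussenInvariant s),
    Knot.HasRasmussenInvariant K.reverse s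

variable [SphereEmbedding.SmoothnessFacts] in
/-- **spc4.S28** (the unknot; Rasmussen 2010, §3). The unknot has Rasmussen invariant `0`
(the identity of `Conc(S³)` goes to `0`). Knot-level form of the prelude's
`GaussDiagram.rasmussenInvariant_empty` (the empty Gauss diagram presents the round unknot).
Rasmussen (2010), §3 (remark after Def. 3.4). [cite: Rasmussen2010, §3] -/
def hasRasmussenInvariant_unknot : Prop :=
  unknot.HasRasmussenInvariant 0

/-! ## The slice-genus bound -/

/-- **spc4.S28** (Rasmussen's slice-genus bound; Rasmussen 2010, Thm. 1). For every knot
`|s(K)| ≤ 2 g₄(K)`, where `g₄ = Knot.sliceGenus` is the smooth slice (4-ball) genus: a slice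
surface of genus `g` gives a connected cobordism to the unknot inducing a filtered map of
degree `-2g` on Lee homology which is nonzero on canonical generators.
Rasmussen (2010), Thm. 1. [cite: Rasmussen2010, Thm. 1] -/
def abs_le_two_mul_sliceGenus : Prop :=
  ∀ {K : Knot} {s : ℤ} (h : K.HasRasmussenInvariant s),
    |s| ≤ 2 * (K.sliceGenus : ℤ)

/-- **spc4.S28** (slice knots have `s = 0`; Rasmussen 2010, Thm. 1). A smoothly slice knot
has vanishing Rasmussen invariant (`g₄ = 0` in `abs_le_two_mul_sliceGenus`, via the accepted
bridge `Knot.sliceGenus_eq_zero_iff`). This is the source of the first combinatorial proofs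
that certain topologically slice knots are not smoothly slice.
Relies on: `abs_le_two_mul_sliceGenus`, `Knot.sliceGenus_eq_zero_iff` (sorried).
Rasmussen (2010), Thm. 1, Cor. 1. [cite: Rasmussen2010, Thm. 1] -/
def eq_zero_of_isSmoothlySlice : Prop :=
  ∀ {K : Knot} {s : ℤ} (h : K.HasRasmussenInvariant s) (hs : K.IsSmoothlySlice),
    s = 0

/- interim proof relied on results that are now named facts (D-0014); demoted to a fact by the D-0014 sorry-sweep, proof preserved:
:= by
  have h0 : K.sliceGenus = 0 := (Knot.sliceGenus_eq_zero_iff K).2 hs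
  have := abs_le_two_mul_sliceGenus h
  rw [h0, Nat.cast_zero, mul_zero] at this
  exact abs_nonpos_iff.1 this
-/

/-! ## Torus knots and the Milnor conjecture -/

variable [TorusKnotFacts] in
/-- **spc4.S28** (`s` of torus knots; Rasmussen 2010, Thm. 4). For coprime `p, q ≥ 2` the
torus knot `T(p, q)` has Rasmussen invariant `s(T(p,q)) = (p-1)(q-1)`; more generally
`s(K) = 2 g₄(K) = 2 g(K)` for every positive knot. Rasmussen (2010), Thm. 4, §5.2.

**Convention risk.** The accepted `torusKnot p q hp hq h` is the embedding
`z ↦ (zᵖ, z^q)/√2` (`torusKnotMap`). Depending on the orientation / crossing-sign conventions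
of the accepted `Knot.RegularProjection` and `Knot.HasGaussDiagram` (trunk `FourManM`), its
Gauss diagrams may be those of the *negative* torus knot (all crossings negative), in which
case the correct value is `-((p-1)(q-1))` and this statement should be negated accordingly
(equivalently, stated for `(torusKnot p q hp hq h).mirror`). The reviewer / prover resolves
the sign; the statement id **spc4.S28** is unaffected. [cite: Rasmussen2010, Thm. 4] -/
def hasRasmussenInvariant_torusKnot : Prop :=
  ∀ (p q : ℕ) (hp : 2 ≤ p) (hq : 2 ≤ q) (h : p.Coprime q),
    (torusKnot p q hp hq h).HasRasmussenInvariant (((p : ℤ) - 1) * ((q : ℤ) - 1))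

variable [TorusKnotFacts] in
/-- The **Milnor conjecture** (Kronheimer–Mrowka 1993; combinatorial proof: Rasmussen 2010,
Cor. 3): the smooth slice genus of the torus knot `T(p, q)` (`p, q ≥ 2` coprime) is
`g₄(T(p,q)) = (p-1)(q-1)/2`. The `ℕ`-arithmetic is exact: `p, q ≥ 2` so the subtractions do
not truncate, and `(p-1)(q-1)` is even since coprime `p, q` are not both even. The value is
insensitive to the chirality question flagged at `hasRasmussenInvariant_torusKnot`
(`Knot.sliceGenus_mirror`). Kronheimer–Mrowka, *Gauge theory for embedded surfaces I*,
Topology 32 (1993), Cor. 1.3; Rasmussen (2010), Cor. 3; Milnor (1968), §10. [cite: KronheimerMrowka1993] -/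
def sliceGenus_torusKnot : Prop :=
  ∀ (p q : ℕ) (hp : 2 ≤ p) (hq : 2 ≤ q) (h : p.Coprime q),
    (torusKnot p q hp hq h).sliceGenus = (p - 1) * (q - 1) / 2

end SPC4

end Literature.Topology.FourManifolds
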